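import Mathlib
import HarnessLib
import Summits.Ventures.LatticeQCDFlow.Exactness.TransformedKernel
import Summits.Ventures.LatticeQCDFlow.Exactness.MomentumRefresh
import Summits.Ventures.LatticeQCDFlow.Exactness.InvolutiveMetropolis

/-!
# Symmetries of FT-HMC kernels: an involutive-Metropolis / refresh–update–forget / reported kernel commutes with every symmetry of its data

HONEST FRAMING: exact (Metropolis-corrected) sampling algorithms for lattice gauge theory;
figures of merit are autocorrelation/cost numbers at stated couplings and volumes; no
continuum-physics claim.

Venture `LatticeQCDFlow` (cell pub-lqcd), topic `Exactness`; FANOUT row 14 (`eng-flowhmc`).  NEW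
WORK of the cell; nothing is cited as a fact; no number.  The GEN-9 gauge files
(`SU2StapleFieldCovariance`, `SU2MaskedKickJacobianInvariance`, `SU2MemberGaugeCovariance`,
`U1GaugeCovariance`) show that the engine's maps are equivariant and its pulled-back Hamiltonian
invariant.  This file is the KERNEL-LEVEL toolkit that turns such facts into "the Markov kernel
commutes with the symmetry" — in the tree's vocabulary, a symmetry `Θ : Ω ≃ᵐ Ω` of a kernel `κ`
is the identity `conjKernel κ Θ = κ` (`conjKernel κ Θ x = Θ_* κ(Θ⁻¹ x)`, row 7's
`TransformedKernel.lean`).  Everything is stated for arbitrary measurable spaces: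

* **`conjKernel_involMH_of_comm`** — the involutive-Metropolis kernel `involMH Φ H` (row 30)
  commutes with every `Θ` that commutes with the proposal `Φ` and preserves `H`;
* **`conjKernel_refreshUpdate_prodCongr`** — reporting a refresh–update–forget kernel through `Θ`
  on configurations is the refresh–update–forget kernel of the phase-space kernel reported through
  `Θ × R`, for ANY `R : P ≃ᵐ P` preserving the momentum law (`MomentumRefresh.conjKernel_refreshUpdate`
  is the case `R = id`); hence **`conjKernel_refreshUpdate_eq_self`** — if the phase-space kernel
  commutes with `Θ × R` then the configuration kernel commutes with `Θ`;
* **`conjKernel_conjKernel_eq_self_of_comm`** — a kernel reported through an EQUIVARIANT map `F`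
  (`F ∘ Θ = Θ' ∘ F`) inherits the symmetry: `conjKernel κ Θ = κ ⇒ conjKernel (conjKernel κ F) Θ' = conjKernel κ F`;
* `invariant_map_of_conjKernel_eq_self` — a symmetry maps invariant laws to invariant laws;
* **`thmc_conjKernel_eq_self`** — ASSEMBLY: the FT-HMC configuration kernel
  `F ∘ (refresh ∘ involMH Φ H̃ ∘ forget) ∘ F⁻¹` commutes with `Θ` whenever the proposal commutes
  with `Θ × R`, `H̃ ∘ (Θ × R) = H̃`, `R_* μP = μP`, and `F ∘ Θ = Θ ∘ F`.

NOT CLAIMED: the instantiation for gauge transformations of the `SU(2)` / `U(1)` rungs (needs the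
momentum rotation `p ↦ Ad_g p` as a measure-preserving equivalence and a COVARIANT-FORCE
hypothesis for the kick; left to a sequel); any number.
-/

noncomputable section

namespace Summit.Ventures.LatticeQCDFlow.Exactness

open MeasureTheory ProbabilityTheory ProbabilityTheory.Kernel Set
open scoped ENNReal

/-! ## Involutive Metropolis kernels inherit symmetries -/

section InvolMH

variable {Ω : Type*} [MeasurableSpace Ω]

/-- **`involMH Φ H` commutes with every symmetry of `(Φ, H)`.**  If `Θ : Ω ≃ᵐ Ω` commutes with
the proposal (`Φ (Θ z) = Θ (Φ z)`) and preserves the Hamiltonian (`H (Θ z) = H z`), then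
`conjKernel (involMH Φ hΦ H) Θ = involMH Φ hΦ H`. -/
theorem conjKernel_involMH_of_comm {Φ : Ω → Ω} {hΦ : Measurable Φ} {H : Ω → ℝ} (hH : Measurable H)
    (Θ : Ω ≃ᵐ Ω) (hcomm : ∀ z, Φ (Θ z) = Θ (Φ z)) (hHΘ : ∀ z, H (Θ z) = H z) :
    conjKernel (involMH Φ hΦ H) Θ = involMH Φ hΦ H := by
  ext x B hB
  have hcomm' : Φ (Θ.symm x) = Θ.symm (Φ x) := by
    apply Θ.injective
    rw [← hcomm, Θ.apply_symm_apply, Θ.apply_symm_apply]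
  have hacc : involAcceptE H Φ (Θ.symm x) = involAcceptE H Φ x := by
    unfold involAcceptE involAccept
    rw [hcomm', ← hHΘ (Θ.symm x), ← hHΘ (Θ.symm (Φ x)), Θ.apply_symm_apply, Θ.apply_symm_apply]
  have hmem : ∀ y : Ω, (Θ.symm y ∈ Θ ⁻¹' B) ↔ (y ∈ B) := fun y => by
    rw [Set.mem_preimage, Θ.apply_symm_apply]
  have hind : ∀ y : Ω, (Θ ⁻¹' B).indicator (1 : Ω → ℝ≥0∞) (Θ.symm y) = B.indicator 1 y := by
    intro y
    by_cases h : y ∈ B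
    · rw [Set.indicator_of_mem ((hmem y).mpr h), Set.indicator_of_mem h]
      rfl
    · rw [Set.indicator_of_notMem (fun h' => h ((hmem y).mp h')), Set.indicator_of_notMem h]
  have hind1 : (Θ ⁻¹' B).indicator (1 : Ω → ℝ≥0∞) (Φ (Θ.symm x)) = B.indicator 1 (Φ x) := by
    rw [hcomm']
    exact hind (Φ x)
  have hind2 : (Θ ⁻¹' B).indicator (1 : Ω → ℝ≥0∞) (Θ.symm x) = B.indicator 1 x := hind x
  rw [conjKernel_apply' _ _ _ hB, involMH_apply hH _ (Θ.measurable hB), involMH_apply hH _ hB, hacc,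
    hind1, hind2]

end InvolMH

/-! ## Refresh–update–forget kernels inherit symmetries -/

section Refresh

variable {Ω P : Type*} [MeasurableSpace Ω] [MeasurableSpace P]

/-- **Reporting a refresh–update–forget kernel through `Θ` = refreshing, running the phase-space
kernel reported through `Θ × R`, forgetting** — for every `R : P ≃ᵐ P` that preserves the
momentum law `μP`. -/
theorem conjKernel_refreshUpdate_prodCongr (κ : Kernel (Ω × P) (Ω × P)) (μP : Measure P) [SFinite μP]
    (Θ : Ω ≃ᵐ Ω) (R : P ≃ᵐ P) (hR : μP.map R = μP) :
    conjKernel (refreshUpdate κ μP) Θ = refreshUpdate (conjKernel κ (Θ.prodCongr R)) μP := by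
  ext x A hA
  rw [conjKernel_apply' _ _ _ hA, refreshUpdate_apply' _ _ _ (Θ.measurable hA),
    refreshUpdate_apply' _ _ _ hA]
  have hset : (Θ.prodCongr R) ⁻¹' (Prod.fst ⁻¹' A : Set (Ω × P)) = Prod.fst ⁻¹' (Θ ⁻¹' A) := by
    ext z
    simp [MeasurableEquiv.prodCongr]
  have hpt : ∀ π : P, (Θ.prodCongr R).symm (x, π) = (Θ.symm x, R.symm π) := fun π => rfl
  simp_rw [conjKernel_apply' _ _ _ (measurable_fst hA), hset, hpt]
  -- change variables `π ↦ R π` in the momentum integral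
  symm
  calc ∫⁻ π, κ (Θ.symm x, R.symm π) (Prod.fst ⁻¹' (Θ ⁻¹' A)) ∂μP
      = ∫⁻ π, κ (Θ.symm x, R.symm π) (Prod.fst ⁻¹' (Θ ⁻¹' A)) ∂(μP.map R) := by rw [hR]
    _ = ∫⁻ π, κ (Θ.symm x, R.symm (R π)) (Prod.fst ⁻¹' (Θ ⁻¹' A)) ∂μP := lintegral_map_equiv _ R
    _ = ∫⁻ π, κ (Θ.symm x, π) (Prod.fst ⁻¹' (Θ ⁻¹' A)) ∂μP := by
        simp only [MeasurableEquiv.symm_apply_apply]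

/-- **Hence: if the phase-space kernel commutes with `Θ × R` (and `R` preserves the momentum law),
the configuration kernel commutes with `Θ`.** -/
theorem conjKernel_refreshUpdate_eq_self (κ : Kernel (Ω × P) (Ω × P)) (μP : Measure P) [SFinite μP]
    (Θ : Ω ≃ᵐ Ω) (R : P ≃ᵐ P) (hR : μP.map R = μP) (hκ : conjKernel κ (Θ.prodCongr R) = κ) :
    conjKernel (refreshUpdate κ μP) Θ = refreshUpdate κ μP := by
  rw [conjKernel_refreshUpdate_prodCongr κ μP Θ R hR, hκ]

end Refresh

/-! ## Reported kernels inherit symmetries through equivariant maps -/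

section Reported

variable {Ω Ω' : Type*} [MeasurableSpace Ω] [MeasurableSpace Ω']

/-- **A kernel reported through an equivariant map inherits the symmetry.**  If `κ` commutes with
`Θ` and `F ∘ Θ = Θ' ∘ F` (as measurable equivalences: `Θ.trans F = F.trans Θ'`), then the reported
kernel `conjKernel κ F` commutes with `Θ'`. -/
theorem conjKernel_conjKernel_eq_self_of_comm (κ : Kernel Ω Ω) (F : Ω ≃ᵐ Ω') (Θ : Ω ≃ᵐ Ω)
    (Θ' : Ω' ≃ᵐ Ω') (hκ : conjKernel κ Θ = κ) (hF : Θ.trans F = F.trans Θ') :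
    conjKernel (conjKernel κ F) Θ' = conjKernel κ F := by
  rw [conjKernel_conjKernel, ← hF, ← conjKernel_conjKernel, hκ]

/-- A symmetry of a kernel maps invariant laws to invariant laws. -/
theorem invariant_map_of_conjKernel_eq_self {κ : Kernel Ω Ω} (Θ : Ω ≃ᵐ Ω)
    (hκ : conjKernel κ Θ = κ) {μ : Measure Ω} (hμ : Invariant κ μ) : Invariant κ (μ.map Θ) := by
  have h := invariant_conjKernel hμ Θ
  rwa [hκ] at h

end Reported

/-! ## Assembly: the FT-HMC configuration kernel commutes with every symmetry of its data -/

section Assembly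

variable {Ω P : Type*} [MeasurableSpace Ω] [MeasurableSpace P]

/-- **The FT-HMC configuration kernel inherits every symmetry of its data.**  Phase space
`Ω × P`, proposal `Φ` (measurable), pulled-back Hamiltonian `H̃`, momentum law `μP`, reporting map
`F : Ω ≃ᵐ Ω`; symmetry `Θ` of the configurations and `R` of the momenta.  If the proposal
commutes with `Θ × R`, `H̃` is `Θ × R`-invariant, `R` preserves `μP`, and `F` is `Θ`-equivariant,
then the reported kernel `K = F ∘ (refresh; involMH Φ H̃; forget) ∘ F⁻¹` satisfies
`conjKernel K Θ = K` — i.e. `K(Θ u, Θ A) = K(u, A)`. -/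
theorem thmc_conjKernel_eq_self {Φ : Ω × P → Ω × P} {hΦ : Measurable Φ} {H : Ω × P → ℝ}
    (hH : Measurable H) (μP : Measure P) [SFinite μP] (F Θ : Ω ≃ᵐ Ω) (R : P ≃ᵐ P)
    (hcomm : ∀ z, Φ (Θ.prodCongr R z) = Θ.prodCongr R (Φ z)) (hHΘ : ∀ z, H (Θ.prodCongr R z) = H z)
    (hR : μP.map R = μP) (hF : Θ.trans F = F.trans Θ) :
    conjKernel (conjKernel (refreshUpdate (involMH Φ hΦ H) μP) F) Θ =
      conjKernel (refreshUpdate (involMH Φ hΦ H) μP) F :=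
  conjKernel_conjKernel_eq_self_of_comm _ F Θ Θ
    (conjKernel_refreshUpdate_eq_self _ μP Θ R hR (conjKernel_involMH_of_comm hH _ hcomm hHΘ)) hF

end Assembly

end Summit.Ventures.LatticeQCDFlow.Exactness
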